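import Literature.NumberTheory.LFunctions.HybridJointUniversalityShifts
import Literature.NumberTheory.LFunctions.HybridJointUniversalityReduction
import Literature.NumberTheory.LFunctions.DirichletLFunctionEulerProductMeanSquareUniform
import Literature.NumberTheory.LFunctions.ZetaUniversalityDiscMain
import HarnessLib

/-!
# Hybrid joint universality on discs — the main assembly (Pańkowski 2010, Theorem 1.1 on discs)

This file discharges the named fact
`Literature.NumberTheory.LFunctions.Pankowski2010_thm1_1_discAnalytic`
(`HybridJointUniversality.lean`): for pairwise non-equivalent Dirichlet characters `χ₁,…,χₙ`,
a closed disc `|s − c| ≤ ρ` inside `1/2 < Re s < 1`, targets `fᵢ` holomorphic on a larger disc and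
zero-free on the closed disc, `ℚ`-linearly independent reals `α₁,…,αₘ`, reals `θ₁,…,θₘ` and
`ε > 0`, the set of `τ ∈ [0, T]` with `max_i max_{|s−c|≤ρ} |L(s + iτ, χᵢ) − fᵢ(s)| < ε` and
`min_k ‖τ αₖ − θₖ‖ < ε` has measure `≥ δ T` for some `δ > 0` and all large `T`
[cite: Pankowski2010, Theorem 1.1 (with Lemma 2.2, Remark 2.1, Lemma 3.1 and Theorem 4.2),
pp. 60–69].

## The proof

It is the proof of the source, run on discs in the first-order architecture of the tree's proof of
Voronin's theorem (`Steuding2007_thm1_9_discAnalytic_holds`, `ZetaUniversalityDiscMain.lean`):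

1. *Diophantine data* [cite: Pankowski2010, Lemma 2.2]: `Pankowski.exists_hybrid_frequencies`
   gives `J ⊆ {1,…,m}`, a finite set of primes `B`, `N ≥ 1`, phases `θB` and `L > 0` such that the
   reals `(αⱼ/N)_{j∈J}` together with `(log p/2πN)_{p∈B}` and `(log p/2π)_{p∉B}` are `ℚ`-linearly
   independent, and such that `‖τ αⱼ/N − θⱼ/N‖ < e (j ∈ J)`, `‖τ log p/2πN − θB_p‖ < e (p ∈ B)` imply
   `‖τ αₖ − θₖ‖ < L e` for all `k`.
2. *Joint denseness* [cite: Pankowski2010, Remark 2.1, Lemma 3.1]: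
   `HybridShifts.exists_joint_eulerProduct_near_complex` steers a finite twisted Euler product
   over a set of primes `M` disjoint from `B` onto `gᵢ = fᵢ · ∏_{p∈B}(1 − χᵢ(p)e(−NθB_p)p^{−s})`,
   simultaneously for all `i`; the frozen `B`-factors are put back, so that on the fixed torus
   `(ℝ/ℤ)^{M ∪ B}` the full steering product (`HybridMain.Zf`, phases `e(θ_p)` on `M` and
   `e(Nθ_p)` on `B`) is `ε/8`-close to `fᵢ` at the centre `θf₀` and `ε/4`-close on a box around it.
3. *Mean square* [cite: Pankowski2010, §4]: every `L(s, χᵢ)` is approximated in mean square on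
   vertical segments by `∏_{p<P}(1 − χᵢ(p)p^{−s})⁻¹`, uniformly on the circle `|s − c| = ρ'`
   (`CharEulerProductMeanSquare.LFunction_sub_finiteEulerProduct_meanSquare_uniform`), and the
   tail logarithm `∑_{p<P, p∉M∪B}` has small mean square on the torus
   (`HybridTorus.integral_mul_circleMeanSquare_Lt_le`).
4. *Kronecker–Weyl on the hybrid torus* `(ℝ/ℤ)^{J ⊔ {p < P}}` for the `ℤ`-independent
   frequencies `(αⱼ/N)_{j∈J}, (−log p/2πN)_{p∈B}, (−log p/2π)_{p∉B}`
   (`Pankowski.linearIndependent_int_frequencies`,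
   `KroneckerWeyl.tendsto_avg_integral_comp_flow_real`), applied to a continuous bump `φ`
   supported in the box and to `φ ·` (circle mean square of the tail), and the time integral of
   the `L − ∏_{p<P}` mean square; the bookkeeping `VoroninAssembly.integral_bookkeeping` produces a
   set of good shifts of measure `≥ δ T`.
5. At a good shift, `HybridShifts.norm_LFunction_sub_lt_of_good` gives
   `|L(s + iτ, χᵢ) − fᵢ(s)| < ε` on the disc for every `i` [cite: Pankowski2010, (14)–(16)], and the
   `J`- and `B`-coordinates of the flow being in the box give, by the transfer of Step 1,
   `‖τ αₖ − θₖ‖ < ε` for every `k` [cite: Pankowski2010, (4)–(7)].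

No new named facts are introduced; `HybridMain.ephf`, `HybridMain.Zf` are auxiliary definitions
(the steering phases and product on the fixed torus) with their API.
-/

noncomputable section

open Complex Filter Set Metric MeasureTheory Topology
open scoped Real

namespace Literature.NumberTheory.LFunctions

open VoroninTools VoroninTorus VoroninAssembly HybridTorus HybridShifts
open Literature.NumberTheory.DiophantineApproximation
open Literature.Barriers.RiemannHypothesis.BohrCourant (fourier_one_coe norm_fourier_one
  pow_le_measureReal_box measurableSet_box)

/-! ### The steering product on the fixed torus `(ℝ/ℤ)^{St}` -/

namespace HybridMain

/-- The phase of a steering prime on the fixed torus `(ℝ/ℤ)^{St}`: `e(θ_n)`, or `e(Nn θ_n)` for the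
exceptional primes `n ∈ B`. [folklore] -/
def ephf (B : Finset ℕ) (Nn : ℕ) {St : Finset ℕ} (θ : UnitAddTorus ↥St) (n : ↥St) : ℂ :=
  if (n : ℕ) ∈ B then fourier (Nn : ℤ) (θ n) else fourier 1 (θ n)

/-- `|ephf| = 1`. [folklore] -/
theorem norm_ephf (B : Finset ℕ) (Nn : ℕ) {St : Finset ℕ} (θ : UnitAddTorus ↥St) (n : ↥St) :
    ‖ephf B Nn θ n‖ = 1 := by
  unfold ephf
  split_ifs
  · rw [fourier_apply]; exact Circle.norm_coe _
  · exact norm_fourier_one _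

/-- `θ ↦ ephf θ n` is continuous. [folklore] -/
theorem continuous_ephf (B : Finset ℕ) (Nn : ℕ) {St : Finset ℕ} (n : ↥St) :
    Continuous fun θ : UnitAddTorus ↥St ↦ ephf B Nn θ n := by
  unfold ephf
  split_ifs
  · exact (fourier (Nn : ℤ)).continuous.comp (continuous_apply _)
  · exact (fourier 1).continuous.comp (continuous_apply _)

/-- The steering product of the character `χ` on the fixed torus. [folklore] -/
def Zf (B : Finset ℕ) (Nn : ℕ) (St : Finset ℕ) {q : ℕ} (χ : DirichletCharacter ℂ q)
    (p : ℂ × UnitAddTorus ↥St) : ℂ :=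
  ∏ n : ↥St, (1 - χ (n : ℕ) * ((n : ℕ) : ℂ) ^ (-p.1) * ephf B Nn p.2 n)⁻¹

/-- The steering product on the big torus is the fixed-torus product of the restriction. [folklore] -/
theorem Zst_eq_Zf {κ : Type} (J : Finset κ) (P : ℕ) (B : Finset ℕ) (Nn : ℕ) {St : Finset ℕ}
    (hStP : St ⊆ P.primesBelow) {q : ℕ} (χ : DirichletCharacter ℂ q) (s : ℂ)
    (θ : UnitAddTorus (↥J ⊕ ↥(P.primesBelow))) :
    Zst J P B Nn St (fun n ↦ χ n) s θ =
      Zf B Nn St χ (s, fun n : ↥St ↦ θ (Sum.inr ⟨n.1, hStP n.2⟩)) := by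
  classical
  unfold Zst Zf
  have hfilt : (P.primesBelow).filter (· ∈ St) = St := by
    ext n; simp only [Finset.mem_filter]
    exact ⟨fun h ↦ h.2, fun h ↦ ⟨hStP h, h⟩⟩
  rw [hfilt, ← Finset.prod_coe_sort St]
  refine Finset.prod_congr rfl fun n _ ↦ ?_
  congr 2
  unfold eph ephf
  rw [dif_pos (hStP n.2)]

/-- The fixed-torus steering product is continuous on `{Re s > 0} × torus`. [folklore] -/
theorem continuousOn_Zf (B : Finset ℕ) (Nn : ℕ) (St : Finset ℕ) (hSt : ∀ n ∈ St, n.Prime) {q : ℕ}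
    (χ : DirichletCharacter ℂ q) :
    ContinuousOn (Zf B Nn St χ) ({s : ℂ | 0 < s.re} ×ˢ univ) := by
  unfold Zf
  refine continuousOn_finsetProd _ fun n _ ↦ ?_
  have hpr : (n : ℕ).Prime := hSt n n.2
  have hn0 : ((n : ℕ) : ℂ) ≠ 0 := by exact_mod_cast hpr.ne_zero
  have hc : Continuous fun p : ℂ × UnitAddTorus ↥St ↦
      (1 : ℂ) - χ (n : ℕ) * ((n : ℕ) : ℂ) ^ (-p.1) * ephf B Nn p.2 n :=
    continuous_const.sub ((continuous_const.mul (Continuous.const_cpow continuous_fst.neg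
      (Or.inl hn0))).mul ((continuous_ephf B Nn n).comp continuous_snd))
  refine hc.continuousOn.inv₀ fun p hp ↦ ?_
  intro h
  have hre : 0 < p.1.re := hp.1
  have hlt : ‖χ (n : ℕ) * ((n : ℕ) : ℂ) ^ (-p.1) * ephf B Nn p.2 n‖ < 1 := by
    refine (norm_datum_le (a := fun m ↦ χ m) (fun m ↦ χ.norm_le_one _) hpr.ne_zero p.1
      (norm_ephf B Nn p.2 n)).trans_lt ?_
    exact Real.rpow_lt_one_of_one_lt_of_neg (by exact_mod_cast hpr.one_lt) (by linarith)
  rw [sub_eq_zero] at h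
  rw [← h, norm_one] at hlt
  exact lt_irrefl _ hlt

/-- **The steering product at the centre of the box.** With `St = M ∪ B` (disjoint), the centre
`θf₀ n = ϑ_n` (`n ∈ M`), `= −θB_n` (`n ∈ B`):
`Zf(s, θf₀) = (∏_{p∈M} (1 − χ(p) p^{−s} e(ϑ_p))⁻¹) · (∏_{p∈B} (1 − χ(p) e(−Nn θB_p) p^{−s}))⁻¹`.
[cite: Pankowski2010, Lemma 3.1 (proof: f̃ⱼ = fⱼ ∏_{p∈B} R_p⁻¹(p^{−s} e(−θ*_p)))] -/
theorem Zf_centre (B : Finset ℕ) (Nn : ℕ) {M : Finset ℕ} (hMB : Disjoint M B) {q : ℕ}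
    (χ : DirichletCharacter ℂ q) (ϑ θB : ℕ → ℝ) (s : ℂ) :
    Zf B Nn (M ∪ B) χ (s, fun n : ↥(M ∪ B) ↦
      if (n : ℕ) ∈ M then ((ϑ n : ℝ) : UnitAddCircle) else ((-θB n : ℝ) : UnitAddCircle)) =
      (∏ p ∈ M, (1 - χ p * (p : ℂ) ^ (-s) * cexp (2 * Real.pi * I * ϑ p))⁻¹) *
        (∏ p ∈ B, (1 - χ p * cexp (-(2 * Real.pi * I * ((Nn : ℝ) * θB p : ℝ))) *
          (p : ℂ) ^ (-s)))⁻¹ := by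
  classical
  set g : ℕ → ℂ := fun m ↦ (1 - χ m * (m : ℂ) ^ (-s) *
      (if m ∈ B then fourier (Nn : ℤ)
          (if m ∈ M then ((ϑ m : ℝ) : UnitAddCircle) else ((-θB m : ℝ) : UnitAddCircle))
        else fourier 1
          (if m ∈ M then ((ϑ m : ℝ) : UnitAddCircle) else ((-θB m : ℝ) : UnitAddCircle))))⁻¹
    with hg
  have h1 : Zf B Nn (M ∪ B) χ (s, fun n : ↥(M ∪ B) ↦
      if (n : ℕ) ∈ M then ((ϑ n : ℝ) : UnitAddCircle) else ((-θB n : ℝ) : UnitAddCircle)) =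
      ∏ n : ↥(M ∪ B), g n := by
    unfold Zf ephf
    rfl
  rw [h1, Finset.prod_coe_sort (M ∪ B) g, Finset.prod_union hMB, ← Finset.prod_inv_distrib]
  congr 1
  · refine Finset.prod_congr rfl fun p hp ↦ ?_
    have hpB : p ∉ B := Finset.disjoint_left.1 hMB hp
    simp only [hg, if_neg hpB, if_pos hp, fourier_one_coe]
  · refine Finset.prod_congr rfl fun p hp ↦ ?_
    have hpM : p ∉ M := Finset.disjoint_right.1 hMB hp
    simp only [hg, if_pos hp, if_neg hpM, fourier_coe_apply]
    congr 2
    rw [mul_assoc (χ p : ℂ), mul_comm ((p : ℂ) ^ (-s)), ← mul_assoc]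
    congr 2
    push_cast
    ring_nf

/-- The inverse of the frozen `B`-factors is bounded by `4^{#B}` (`Re s > 1/2`). [folklore] -/
theorem norm_prod_B_inv_le (B : Finset ℕ) (hB : ∀ p ∈ B, p.Prime) {q : ℕ} (χ : DirichletCharacter ℂ q)
    (Nn : ℕ) (θB : ℕ → ℝ) {s : ℂ} (hs : 1 / 2 < s.re) :
    ‖(∏ p ∈ B, (1 - χ p * cexp (-(2 * Real.pi * I * ((Nn : ℝ) * θB p : ℝ))) * (p : ℂ) ^ (-s)))⁻¹‖ ≤
      4 ^ B.card := by
  rw [← Finset.prod_inv_distrib, norm_prod]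
  calc ∏ p ∈ B, ‖(1 - χ p * cexp (-(2 * Real.pi * I * ((Nn : ℝ) * θB p : ℝ))) * (p : ℂ) ^ (-s))⁻¹‖
      ≤ ∏ _p ∈ B, (4 : ℝ) := by
        refine Finset.prod_le_prod (fun _ _ ↦ norm_nonneg _) fun p hp ↦ ?_
        have he : ‖χ p * cexp (-(2 * Real.pi * I * ((Nn : ℝ) * θB p : ℝ)))‖ ≤ 1 := by
          rw [norm_mul, show -(2 * (Real.pi : ℂ) * I * ((Nn : ℝ) * θB p : ℝ)) =
            ((-(2 * Real.pi * ((Nn : ℝ) * θB p)) : ℝ) : ℂ) * I by push_cast; ring,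
            Complex.norm_exp_ofReal_mul_I, mul_one]
          exact χ.norm_le_one _
        exact (norm_one_sub_le_two_and_norm_inv_le_four
          (norm_mul_cpow_neg_le_three_quarters (hB p hp) he hs)).2
    _ = 4 ^ B.card := Finset.prod_const _

end HybridMain

/-! ### The theorem -/

open HybridMain

set_option maxHeartbeats 2000000 in
/-- **Hybrid joint universality of Dirichlet `L`-functions on discs (Pańkowski 2010, Theorem 1.1
for `K` a closed disc and targets analytic on a larger disc) — PROVED.** The discharge of the named
fact `Literature.NumberTheory.LFunctions.Pankowski2010_thm1_1_discAnalytic`. Proof = the proof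
of the source (Lemma 2.2 + Remark 2.1 + Lemma 3.1 + Thm. 4.2, pp. 62–69) on discs, in the
first-order architecture of the tree's proof of Voronin's theorem
(`Steuding2007_thm1_9_discAnalytic_of_facts`): Diophantine data `J, B, N, θB`
(`Pankowski.exists_hybrid_frequencies`); joint denseness of twisted Euler products for the
non-equivalent `χᵢ` with the primes of `B` excluded and their factors frozen at the phases
`−N θB_p` (`HybridShifts.exists_joint_eulerProduct_near_complex`); the Kronecker–Weyl theorem on
the torus `(ℝ/ℤ)^{J ⊔ primes<P}` for the `ℤ`-independent frequencies
`(αⱼ/N)_{j∈J}, (−ℓ(p)/N)_{p∈B}, (−ℓ(p))_{p∉B}` (`Pankowski.linearIndependent_int_frequencies`,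
`KroneckerWeyl.tendsto_avg_integral_comp_flow_real`); the mean-square approximation of every
`L(s, χᵢ)` by finite Euler products (`CharEulerProductMeanSquare.LFunction_sub_finiteEulerProduct_meanSquare_uniform`);
Cauchy's formula from circles to discs; and at a good shift `τ`: `|L(s+iτ, χᵢ) − fᵢ(s)| < ε` on the
disc for all `i` (`HybridShifts.norm_LFunction_sub_lt_of_good`) and `‖τ αₖ − θₖ‖ < ε` for all `k`
(the transfer (4)–(7) of Lemma 2.2). [cite: Pankowski2010, Thm. 1.1, Lemma 2.2, Remark 2.1, Lemma 3.1, Thm. 4.2] -/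
theorem Pankowski2010_thm1_1_discAnalytic_holds : Pankowski2010_thm1_1_discAnalytic := by
  intro ι _ _ q _ χ hχ c ρ R hρ hρR h1 h2 f hfd hf0 κ _ _ α hα θ ε₀ hε₀
  classical
  -- WLOG `ε ≤ 1`
  obtain ⟨ε, hε, hε1, hεε₀⟩ : ∃ ε : ℝ, 0 < ε ∧ ε ≤ 1 ∧ ε ≤ ε₀ :=
    ⟨min ε₀ 1, lt_min hε₀ one_pos, min_le_right _ _, min_le_left _ _⟩
  suffices H : ∃ δ : ℝ, 0 < δ ∧ ∃ T₀ : ℝ, ∀ T : ℝ, T₀ ≤ T → ENNReal.ofReal (δ * T) ≤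
      volume ({τ : ℝ | (∀ i, ∀ s ∈ closedBall c ρ, ‖(χ i).LFunction (s + τ * I) - f i s‖ < ε) ∧
        ∀ k, ∃ m : ℤ, |τ * α k - θ k - m| < ε} ∩ Icc 0 T) by
    obtain ⟨δ, hδ, T₀, hT⟩ := H
    refine ⟨δ, hδ, T₀, fun T hTT ↦ (hT T hTT).trans (measure_mono ?_)⟩
    refine inter_subset_inter_left _ fun τ hτ ↦ ⟨fun i s hs ↦ (hτ.1 i s hs).trans_le hεε₀, fun k ↦ ?_⟩
    obtain ⟨m, hm⟩ := hτ.2 k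
    exact ⟨m, hm.trans_le hεε₀⟩
  /- Step 0: radii `ρ < ρ'` (circle, inside the strip) and `ρ < R₁` (zero-free disc for all `fᵢ`). -/
  obtain ⟨R₁, hρR₁, hR₁R, hF0⟩ := exists_gt_forall_closedBall_ne_zero (g := fun s ↦ ∏ i, f i s) hρ.le hρR
    ((continuousOn_finsetProd _ fun i _ ↦ (hfd i).continuousOn)) (fun s hs ↦
      Finset.prod_ne_zero_iff.2 fun i _ ↦ hf0 i s hs)
  have hf0' : ∀ i, ∀ s ∈ closedBall c R₁, f i s ≠ 0 := fun i s hs ↦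
    (Finset.prod_ne_zero_iff.1 (hF0 s hs)) i (Finset.mem_univ i)
  obtain ⟨ρ', hρρ', hσ₁, hσ₂, hρ'R₁⟩ : ∃ ρ' : ℝ, ρ < ρ' ∧ 1 / 2 < c.re - ρ' ∧ c.re + ρ' < 1 ∧ ρ' < R₁ := by
    refine ⟨ρ + min (min (c.re - ρ - 1 / 2) (1 - c.re - ρ)) (R₁ - ρ) / 2, ?_, ?_, ?_, ?_⟩
    · have : 0 < min (min (c.re - ρ - 1 / 2) (1 - c.re - ρ)) (R₁ - ρ) :=
        lt_min (lt_min (by linarith) (by linarith)) (by linarith)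
      linarith
    · have := (min_le_left _ (R₁ - ρ)).trans (min_le_left (c.re - ρ - 1 / 2) (1 - c.re - ρ))
      linarith
    · have := (min_le_left _ (R₁ - ρ)).trans (min_le_right (c.re - ρ - 1 / 2) (1 - c.re - ρ))
      linarith
    · have := min_le_right (min (c.re - ρ - 1 / 2) (1 - c.re - ρ)) (R₁ - ρ)
      linarith
  have hρ'0 : 0 < ρ' := hρ.trans hρρ'
  obtain ⟨σ₁, hσ₁def⟩ : ∃ σ₁ : ℝ, σ₁ = c.re - ρ' := ⟨_, rfl⟩
  obtain ⟨σ₂, hσ₂def⟩ : ∃ σ₂ : ℝ, σ₂ = c.re + ρ' := ⟨_, rfl⟩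
  obtain ⟨A, hAdef⟩ : ∃ A : ℝ, A = |c.im| + ρ' := ⟨_, rfl⟩
  have hσ₁half : 1 / 2 < σ₁ := by rw [hσ₁def]; exact hσ₁
  have hσ₁σ₂ : σ₁ ≤ σ₂ := by rw [hσ₁def, hσ₂def]; linarith
  have hσ₂one : σ₂ < 1 := by rw [hσ₂def]; exact hσ₂
  have hA0 : 0 ≤ A := by rw [hAdef]; positivity
  -- the circle points
  have hcm_mem : ∀ a : ℝ, circleMap c ρ' a ∈ closedBall c ρ' := fun a ↦
    sphere_subset_closedBall (circleMap_mem_sphere c hρ'0.le a)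
  have hcm_re : ∀ a : ℝ, σ₁ ≤ (circleMap c ρ' a).re ∧ (circleMap c ρ' a).re ≤ σ₂ := by
    intro a
    obtain ⟨ha, hb⟩ := abs_le.1 (abs_re_sub_re_le_of_mem_closedBall (hcm_mem a))
    rw [hσ₁def, hσ₂def]
    exact ⟨by linarith, by linarith⟩
  have hcm_im : ∀ a : ℝ, |(circleMap c ρ' a).im| ≤ A := by
    intro a
    have hz1 : ‖circleMap c ρ' a - c‖ ≤ ρ' := by
      have := hcm_mem a; rwa [mem_closedBall, dist_eq_norm] at this
    have hz2 : |(circleMap c ρ' a - c).im| ≤ ‖circleMap c ρ' a - c‖ := Complex.abs_im_le_norm _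
    rw [sub_im] at hz2
    rw [hAdef]
    have h3 := abs_sub_abs_le_abs_sub (circleMap c ρ' a).im c.im
    linarith [hz2.trans hz1]
  have hre_disc : ∀ s ∈ closedBall c ρ, 1 / 2 < s.re := by
    intro s hs
    obtain ⟨ha, -⟩ := abs_le.1 (abs_re_sub_re_le_of_mem_closedBall hs)
    linarith
  -- Cauchy constant
  obtain ⟨Cc, hCcdef⟩ : ∃ Cc : ℝ, Cc = ρ' ^ 2 / (2 * π * (ρ' - ρ) ^ 2) := ⟨_, rfl⟩
  have hCc0 : 0 < Cc := by
    rw [hCcdef]; have := sub_pos.2 hρρ'; positivity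
  -- a common bound for the `fᵢ` on the disc
  have hbd : ∀ i, ∃ C : ℝ, ∀ s ∈ closedBall c ρ, ‖f i s‖ ≤ C := fun i ↦
    (isCompact_closedBall c ρ).exists_bound_of_continuousOn
      ((hfd i).continuousOn.mono (closedBall_subset_ball hρR))
  choose Cf hCf using hbd
  obtain ⟨Mg, hMgdef⟩ : ∃ Mg : ℝ, Mg = ∑ i, |Cf i| := ⟨_, rfl⟩
  have hMg0 : 0 ≤ Mg := by rw [hMgdef]; exact Finset.sum_nonneg fun i _ ↦ abs_nonneg _
  have hMg : ∀ i, ∀ s ∈ closedBall c ρ, ‖f i s‖ ≤ Mg := fun i s hs ↦ by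
    rw [hMgdef]
    exact ((hCf i s hs).trans (le_abs_self _)).trans
      (Finset.single_le_sum (f := fun j ↦ |Cf j|) (fun j _ ↦ abs_nonneg _) (Finset.mem_univ i))
  -- `δ₁` with `(Mg + 1)(4δ₁) ≤ ε/4`
  obtain ⟨δ₁, hδ₁0, hδ₁s, hKδ⟩ : ∃ δ₁ : ℝ, 0 < δ₁ ∧ δ₁ ≤ 1 / 32 ∧ (Mg + 1) * (4 * δ₁) ≤ ε / 4 := by
    refine ⟨ε / (32 * (Mg + 1)), by positivity, ?_, ?_⟩
    · rw [div_le_div_iff₀ (by positivity) (by norm_num)]; nlinarith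
    · have e7 : (Mg + 1) * (4 * (ε / (32 * (Mg + 1)))) = ε / 8 := by field_simp; ring
      rw [e7]; linarith
  -- the number of characters
  obtain ⟨nι, hnιdef⟩ : ∃ nι : ℝ, nι = Fintype.card ι := ⟨_, rfl⟩
  have hnι1 : 1 ≤ nι := by
    rw [hnιdef]; exact_mod_cast Fintype.card_pos
  have hnι0 : 0 < nι := by linarith
  -- thresholds `d` (tail sums on the circle) and `e` (`L − L_P` on the circle)
  obtain ⟨d, hddef⟩ : ∃ d : ℝ, d = δ₁ ^ 2 / Cc := ⟨_, rfl⟩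
  obtain ⟨e, hedef⟩ : ∃ e : ℝ, e = (ε / 4) ^ 2 / Cc := ⟨_, rfl⟩
  have hd0 : 0 < d := by rw [hddef]; positivity
  have he0 : 0 < e := by rw [hedef]; positivity
  have hCcd : Cc * d = δ₁ ^ 2 := by rw [hddef]; field_simp
  have hCce : Cc * e = (ε / 4) ^ 2 := by rw [hedef]; field_simp
  -- the tail level `d/(8π nι)` is below `δ₁`
  have htail_le : d / (8 * π * nι) ≤ δ₁ := by
    have hstep : d / (8 * π * nι) ≤ d / (8 * π) := by
      refine div_le_div_of_nonneg_left hd0.le (by positivity) ?_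
      have : 8 * π * 1 ≤ 8 * π * nι := by gcongr
      linarith
    refine hstep.trans ?_
    rw [hddef, hCcdef, div_div, div_le_iff₀ (by have := sub_pos.2 hρρ'; positivity)]
    have h1' : (ρ' - ρ) ^ 2 ≤ ρ' ^ 2 := by nlinarith
    have h2' : δ₁ ^ 2 ≤ δ₁ := by nlinarith
    calc δ₁ ^ 2 = δ₁ ^ 2 * 1 := by ring
      _ ≤ δ₁ * (ρ' ^ 2 / (2 * π * (ρ' - ρ) ^ 2) * (8 * π)) := by
          have hq : 1 ≤ ρ' ^ 2 / (2 * π * (ρ' - ρ) ^ 2) * (8 * π) := by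
            rw [div_mul_eq_mul_div, le_div_iff₀ (by have := sub_pos.2 hρρ'; positivity)]
            nlinarith [Real.pi_pos]
          nlinarith
  /- Step 1: the Diophantine data `J, B, Nn, θB, L`. -/
  obtain ⟨J, B, Nn, θB, L, hNn, hL, hBp, hLIQ, htransfer⟩ := Pankowski.exists_hybrid_frequencies α θ hα
  -- the Kronecker radius `eK = ε/(2L)`
  obtain ⟨eK, heKdef⟩ : ∃ eK : ℝ, eK = ε / (2 * L) := ⟨_, rfl⟩
  have heK0 : 0 < eK := by rw [heKdef]; positivity
  have hLeK : L * eK < ε := by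
    rw [heKdef]; field_simp; linarith
  /- Step 2: the cut-off `N₁` from the tail `Σ_{k≥N} k^{-2σ₁}`. -/
  obtain ⟨N₁, hN₁4, hN₁tail⟩ : ∃ N₁ : ℕ, 4 ≤ N₁ ∧ ∀ N : ℕ, N₁ ≤ N →
      ∑' k : ℕ, ((k + N : ℕ) : ℝ) ^ (-(2 * σ₁)) < d / (8 * π * nι) := by
    obtain ⟨N₁, hN₁⟩ := eventually_atTop.1
      (((EulerProductMeanSquare.tendsto_tsum_rpow_tail (σ := σ₁)).eventually_lt_const
        (show (0 : ℝ) < d / (8 * π * nι) by positivity)).and (eventually_ge_atTop 4))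
    exact ⟨N₁, (hN₁ N₁ le_rfl).2, fun N hN ↦ (hN₁ N hN).1⟩
  have htailN : ∑' k : ℕ, ((k + N₁ : ℕ) : ℝ) ^ (-(2 * σ₁)) < d / (8 * π * nι) := hN₁tail N₁ le_rfl
  /- Step 3: steering (the joint denseness lemma) with the `B`-twisted targets. -/
  -- the frozen `B`-factors and the twisted targets `gᵢ = fᵢ · ∏_{p∈B} (1 − χᵢ(p) e(−Nn θB_p) p^{−s})`
  obtain ⟨PB, hPB⟩ : ∃ PB : ι → ℂ → ℂ, PB = fun i s ↦
      ∏ p ∈ B, (1 - χ i p * cexp (-(2 * Real.pi * I * ((Nn : ℝ) * θB p : ℝ))) * (p : ℂ) ^ (-s)) :=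
    ⟨_, rfl⟩
  obtain ⟨g, hg⟩ : ∃ g : ι → ℂ → ℂ, g = fun i s ↦ f i s * PB i s := ⟨_, rfl⟩
  obtain ⟨Rd, hRddef⟩ : ∃ Rd : ℝ, Rd = min R₁ ρ' := ⟨_, rfl⟩
  have hρRd : ρ < Rd := by rw [hRddef]; exact lt_min hρR₁ hρρ'
  have hRdre : ∀ s ∈ ball c Rd, 1 / 2 < s.re := by
    intro s hs
    have hs' : s ∈ closedBall c ρ' := by
      rw [mem_ball] at hs; rw [mem_closedBall]
      exact (hs.trans_le (by rw [hRddef]; exact min_le_right _ _)).le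
    obtain ⟨ha, -⟩ := abs_le.1 (abs_re_sub_re_le_of_mem_closedBall hs')
    linarith
  have hPBd : ∀ i, Differentiable ℂ (PB i) := by
    intro i s
    rw [hPB]
    refine DifferentiableAt.fun_finsetProd fun p hp ↦ ?_
    have hp0 : (p : ℂ) ≠ 0 := by exact_mod_cast (hBp p hp).ne_zero
    exact (differentiableAt_const _).sub
      ((differentiableAt_id.neg.const_cpow (Or.inl hp0)).const_mul _)
  have hPB0 : ∀ i, ∀ s : ℂ, 1 / 2 < s.re → PB i s ≠ 0 := by
    intro i s hs
    rw [hPB]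
    refine Finset.prod_ne_zero_iff.2 fun p hp h0 ↦ ?_
    have he : ‖χ i p * cexp (-(2 * Real.pi * I * ((Nn : ℝ) * θB p : ℝ)))‖ ≤ 1 := by
      rw [norm_mul, show -(2 * (Real.pi : ℂ) * I * ((Nn : ℝ) * θB p : ℝ)) =
        ((-(2 * Real.pi * ((Nn : ℝ) * θB p)) : ℝ) : ℂ) * I by push_cast; ring,
        Complex.norm_exp_ofReal_mul_I, mul_one]
      exact (χ i).norm_le_one _
    have h34 := norm_mul_cpow_neg_le_three_quarters (hBp p hp) he hs
    rw [mul_assoc] at h34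
    rw [sub_eq_zero] at h0
    rw [← mul_assoc, ← h0, norm_one] at h34
    norm_num at h34
  have hgd : ∀ i, DifferentiableOn ℂ (g i) (ball c Rd) := by
    intro i; rw [hg]
    exact ((hfd i).mono (ball_subset_ball ((min_le_left _ _).trans hR₁R.le |>.trans' (le_of_eq hRddef)))).mul
      (hPBd i).differentiableOn
  have hg0 : ∀ i, ∀ s ∈ ball c Rd, g i s ≠ 0 := by
    intro i s hs
    rw [hg]
    refine mul_ne_zero (hf0' i s ?_) (hPB0 i s (hRdre s hs))
    exact ball_subset_closedBall (ball_subset_ball (by rw [hRddef]; exact min_le_left _ _) hs)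
  -- the accuracy `η = ε/(8·4^{#B})` and the denseness lemma
  obtain ⟨η, hηdef⟩ : ∃ η : ℝ, η = ε / (8 * 4 ^ B.card) := ⟨_, rfl⟩
  have hη0 : 0 < η := by rw [hηdef]; positivity
  obtain ⟨M, hMp, hMB, hMy, ϑ, hsteer⟩ := exists_joint_eulerProduct_near_complex χ hχ c ρ Rd hρ hρRd
    h1 h2 g hgd hg0 η hη0 N₁ B
  -- the steering set `St = M ∪ B`
  obtain ⟨St, hStdef⟩ : ∃ St : Finset ℕ, St = M ∪ B := ⟨_, rfl⟩
  have hStp : ∀ n ∈ St, n.Prime := by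
    intro n hn; rw [hStdef, Finset.mem_union] at hn
    exact hn.elim (hMp n) (hBp n)
  have hBSt : B ⊆ St := by rw [hStdef]; exact Finset.subset_union_right
  have hMSt : M ⊆ St := by rw [hStdef]; exact Finset.subset_union_left
  -- primes outside `St` are `> N₁`
  have houtside : ∀ n : ℕ, n.Prime → n ∉ St → N₁ < n := by
    intro n hn hnSt
    by_contra hle
    rw [not_lt] at hle
    have hnB : n ∉ B := fun h ↦ hnSt (hBSt h)
    exact hnSt (hMSt (hMy n hn hle hnB))
  /- Step 4: a continuity radius `r` on the fixed torus `(ℝ/ℤ)^{St}`, uniform in `s` and `i`. -/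
  obtain ⟨θf₀, hθf₀⟩ : ∃ θf₀ : UnitAddTorus ↥St, θf₀ = fun n : ↥St ↦
      if (n : ℕ) ∈ M then ((ϑ n : ℝ) : UnitAddCircle) else ((-θB n : ℝ) : UnitAddCircle) := ⟨_, rfl⟩
  have hZf₀ : ∀ i, ∀ s ∈ closedBall c ρ, ‖Zf B Nn St (χ i) (s, θf₀) - f i s‖ < ε / 8 := by
    intro i s hs
    have hsre := hre_disc s hs
    have hcentre := Zf_centre B Nn hMB (χ i) ϑ θB s
    have e1 : Zf B Nn St (χ i) (s, θf₀) = Zf B Nn (M ∪ B) (χ i) (s, fun n : ↥(M ∪ B) ↦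
        if (n : ℕ) ∈ M then ((ϑ n : ℝ) : UnitAddCircle) else ((-θB n : ℝ) : UnitAddCircle)) := by
      subst hStdef; rw [hθf₀]
    have hPBs : PB i s = ∏ p ∈ B, (1 - χ i p * cexp (-(2 * Real.pi * I * ((Nn : ℝ) * θB p : ℝ))) *
        (p : ℂ) ^ (-s)) := by rw [hPB]
    have hne : PB i s ≠ 0 := hPB0 i s hsre
    have hident : Zf B Nn St (χ i) (s, θf₀) - f i s = (PB i s)⁻¹ *
        ((∏ p ∈ M, (1 - χ i p * (p : ℂ) ^ (-s) * cexp (2 * Real.pi * I * ϑ p))⁻¹) - g i s) := by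
      rw [e1, hcentre, hg, ← hPBs]
      field_simp
    rw [hident, norm_mul]
    have hbd := norm_prod_B_inv_le B hBp (χ i) Nn θB hsre
    rw [← hPBs] at hbd
    have hst := hsteer i s hs
    rw [norm_sub_rev] at hst
    calc ‖(PB i s)⁻¹‖ * ‖(∏ p ∈ M, (1 - χ i p * (p : ℂ) ^ (-s) * cexp (2 * Real.pi * I * ϑ p))⁻¹) - g i s‖
        < 4 ^ B.card * η := mul_lt_mul' hbd hst (norm_nonneg _) (by positivity)
      _ = ε / 8 := by rw [hηdef]; field_simp
  have hZfc : ∀ i, ContinuousOn (Zf B Nn St (χ i)) (closedBall c ρ ×ˢ univ) := fun i ↦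
    (continuousOn_Zf B Nn St hStp (χ i)).mono (Set.prod_mono (fun s hs ↦ by
      have := hre_disc s hs; simp only [mem_setOf_eq]; linarith) le_rfl)
  have hrad : ∀ i, ∃ r : ℝ, 0 < r ∧ ∀ θ' : UnitAddTorus ↥St, dist θ' θf₀ < r →
      ∀ s ∈ closedBall c ρ, ‖Zf B Nn St (χ i) (s, θ') - Zf B Nn St (χ i) (s, θf₀)‖ < ε / 8 := fun i ↦
    exists_radius_forall_norm_sub_lt (isCompact_closedBall c ρ) (hZfc i)
      (show (0 : ℝ) < ε / 8 by positivity) θf₀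
  choose ri hri0 hri using hrad
  obtain ⟨r, hr0, hr1, hreK, hrr⟩ : ∃ r : ℝ, 0 < r ∧ r ≤ 1 ∧ r ≤ eK ∧ ∀ i, r ≤ ri i := by
    refine ⟨min (min 1 eK) (Finset.univ.inf' Finset.univ_nonempty ri), ?_, ?_, ?_, ?_⟩
    · refine lt_min (lt_min one_pos heK0) ?_
      obtain ⟨i, -, hi⟩ := Finset.exists_mem_eq_inf' Finset.univ_nonempty ri
      rw [hi]; exact hri0 i
    · exact (min_le_left _ _).trans (min_le_left _ _)
    · exact (min_le_left _ _).trans (min_le_right _ _)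
    · intro i; exact (min_le_right _ _).trans (Finset.inf'_le _ (Finset.mem_univ i))
  have hbox : ∀ i, ∀ θ' : UnitAddTorus ↥St, (∀ n, dist (θ' n) (θf₀ n) < r) →
      ∀ s ∈ closedBall c ρ, ‖Zf B Nn St (χ i) (s, θ') - f i s‖ < ε / 4 := by
    intro i θ' hθ' s hs
    have hd : dist θ' θf₀ < ri i := lt_of_lt_of_le ((dist_pi_lt_iff hr0).2 hθ') (hrr i)
    have h1' := hri i θ' hd s hs
    have h2' := hZf₀ i s hs
    calc ‖Zf B Nn St (χ i) (s, θ') - f i s‖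
        = ‖(Zf B Nn St (χ i) (s, θ') - Zf B Nn St (χ i) (s, θf₀)) + (Zf B Nn St (χ i) (s, θf₀) - f i s)‖ := by
          ring_nf
      _ ≤ ‖Zf B Nn St (χ i) (s, θ') - Zf B Nn St (χ i) (s, θf₀)‖ + ‖Zf B Nn St (χ i) (s, θf₀) - f i s‖ :=
          norm_add_le _ _
      _ < ε / 8 + ε / 8 := add_lt_add h1' h2'
      _ = ε / 4 := by ring
  clear hsteer hZf₀ hZfc hri hrr
  /- Step 5: the box size `rb`, the count `Mb` and the constant `c₁`. -/
  obtain ⟨Mb, hMbdef⟩ : ∃ Mb : ℕ, Mb = J.card + St.card := ⟨_, rfl⟩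
  have hMb1 : 1 ≤ Mb := by
    -- `St` contains `B`, or else the primes `2, 3 ≤ N₁` belong to `M`
    rw [hMbdef]
    have : 1 ≤ St.card := by
      rw [Nat.one_le_iff_ne_zero, Ne, Finset.card_eq_zero]
      intro hSt
      have h2 : (2 : ℕ) ∈ St := by
        by_cases hB2 : 2 ∈ B
        · exact hBSt hB2
        · exact hMSt (hMy 2 Nat.prime_two (by omega) hB2)
      rw [hSt] at h2
      exact absurd h2 (Finset.notMem_empty _)
    omega
  have hMb0 : (0 : ℝ) < Mb := by exact_mod_cast hMb1
  obtain ⟨rb, hrbdef⟩ : ∃ rb : ℝ, rb = r / (4 * Mb) := ⟨_, rfl⟩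
  have hrb0 : 0 < rb := by rw [hrbdef]; positivity
  have hrb1 : rb ≤ 1 := by
    rw [hrbdef, div_le_one (by positivity)]
    have : (1 : ℝ) ≤ Mb := by exact_mod_cast hMb1
    linarith
  obtain ⟨c₁, hc₁def⟩ : ∃ c₁ : ℝ, c₁ = rb ^ Mb / 2 := ⟨_, rfl⟩
  have hc₁0 : 0 < c₁ := by rw [hc₁def]; positivity
  /- Step 6: the mean-square theorem on the circle, for every `i`. -/
  obtain ⟨εE, hεEdef⟩ : ∃ εE : ℝ, εE = e * c₁ / (8 * π * nι) := ⟨_, rfl⟩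
  have hεE0 : 0 < εE := by rw [hεEdef]; positivity
  have hms : ∀ i, ∃ P₀ : ℕ, ∀ P : ℕ, P₀ ≤ P → ∃ T₀ : ℝ, ∀ T : ℝ, T₀ ≤ T →
      ∀ σ : ℝ, σ₁ ≤ σ → σ ≤ σ₂ → ∀ a : ℝ, |a| ≤ A →
        ∫ t in (0 : ℝ)..T, ‖(χ i).LFunction (σ + (t + a) * I) -
          ∏ p ∈ P.primesBelow, (1 - χ i p * (p : ℂ) ^ (-(σ + (t + a) * I : ℂ)))⁻¹‖ ^ 2 ≤ εE * T :=
    fun i ↦ CharEulerProductMeanSquare.LFunction_sub_finiteEulerProduct_meanSquare_uniform (χ i) σ₁ σ₂ A εE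
      hσ₁half hσ₁σ₂ hσ₂one hA0 hεE0
  choose P₀ hP₀ using hms
  obtain ⟨P, hStP', hP₀P⟩ : ∃ P : ℕ, St.sup id < P ∧ ∀ i, P₀ i ≤ P := by
    refine ⟨max (St.sup id + 1) (Finset.univ.sup P₀), ?_, fun i ↦ ?_⟩
    · exact lt_of_lt_of_le (Nat.lt_succ_self _) (le_max_left _ _)
    · exact (Finset.le_sup (f := P₀) (Finset.mem_univ i)).trans (le_max_right _ _)
  have hStP : St ⊆ P.primesBelow := by
    intro n hn
    rw [Nat.mem_primesBelow]
    exact ⟨lt_of_le_of_lt (Finset.le_sup (f := id) hn) hStP', hStp n hn⟩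
  have hT₀i : ∀ i, ∃ T₀ : ℝ, ∀ T : ℝ, T₀ ≤ T → ∀ σ : ℝ, σ₁ ≤ σ → σ ≤ σ₂ → ∀ a : ℝ, |a| ≤ A →
      ∫ t in (0 : ℝ)..T, ‖(χ i).LFunction (σ + (t + a) * I) -
        ∏ p ∈ P.primesBelow, (1 - χ i p * (p : ℂ) ^ (-(σ + (t + a) * I : ℂ)))⁻¹‖ ^ 2 ≤ εE * T :=
    fun i ↦ hP₀ i P (hP₀P i)
  choose T₀i hT₀i using hT₀i
  obtain ⟨T₀, hT₀⟩ : ∃ T₀ : ℝ, ∀ i, T₀i i ≤ T₀ := ⟨Finset.univ.sup' Finset.univ_nonempty T₀i,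
    fun i ↦ Finset.le_sup' T₀i (Finset.mem_univ i)⟩
  clear hP₀ hP₀P
  /- Step 7: the torus `(ℝ/ℤ)^{J ⊔ primes<P}`, its flow and the functions on it. -/
  obtain ⟨l, hl⟩ : ∃ l : ↥J ⊕ ↥(P.primesBelow) → ℝ, l = freq J P B Nn α := ⟨_, rfl⟩
  have hlin : LinearIndependent ℤ l := by
    rw [hl]
    exact Pankowski.linearIndependent_int_frequencies α hLIQ (P.primesBelow)
      fun p hp ↦ Nat.prime_of_mem_primesBelow hp
  obtain ⟨res, hres⟩ : ∃ res : UnitAddTorus (↥J ⊕ ↥(P.primesBelow)) → UnitAddTorus ↥St,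
      res = fun θ' n ↦ θ' (Sum.inr ⟨n.1, hStP n.2⟩) := ⟨_, rfl⟩
  have hresc : Continuous res := by
    rw [hres]; exact continuous_pi fun n ↦ continuous_apply _
  -- the box centre on the big torus
  obtain ⟨θ₀, hθ₀⟩ : ∃ θ₀ : UnitAddTorus (↥J ⊕ ↥(P.primesBelow)), θ₀ = Sum.elim
      (fun j : ↥J ↦ ((θ j / Nn : ℝ) : UnitAddCircle))
      (fun q' : ↥(P.primesBelow) ↦ if (q' : ℕ) ∈ M then ((ϑ q' : ℝ) : UnitAddCircle)
        else ((-θB q' : ℝ) : UnitAddCircle)) := ⟨_, rfl⟩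
  have hresθ₀ : res θ₀ = θf₀ := by
    rw [hres, hθ₀, hθf₀]; rfl
  -- functions on the torus
  obtain ⟨Zt, hZt⟩ : ∃ Zt : ι → ℂ → UnitAddTorus (↥J ⊕ ↥(P.primesBelow)) → ℂ, Zt = fun i s θ' ↦
      Zst J P B Nn St (fun n ↦ χ i n) s θ' := ⟨_, rfl⟩
  obtain ⟨Dt, hDt⟩ : ∃ Dt : UnitAddTorus (↥J ⊕ ↥(P.primesBelow)) → ℝ, Dt = fun θ' ↦
      (∑ j : ↥J, dist (θ' (Sum.inl j)) (θ₀ (Sum.inl j))) +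
        ∑ n : ↥St, dist (res θ' n) (θf₀ n) := ⟨_, rfl⟩
  obtain ⟨φt, hφt⟩ : ∃ φt : UnitAddTorus (↥J ⊕ ↥(P.primesBelow)) → ℝ, φt = fun θ' ↦
      max 0 (1 - 2 / r * Dt θ') := ⟨_, rfl⟩
  obtain ⟨Mt, hMt⟩ : ∃ Mt : UnitAddTorus (↥J ⊕ ↥(P.primesBelow)) → ℝ, Mt = fun θ' ↦
      ∑ i, ∫ a in (0 : ℝ)..2 * π, ‖Lt J P St (fun n ↦ χ i n) (circleMap c ρ' a) θ'‖ ^ 2 := ⟨_, rfl⟩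
  -- the steering product on the big torus is the fixed-torus product of the restriction
  have hZtf : ∀ i (s : ℂ) (θ' : UnitAddTorus (↥J ⊕ ↥(P.primesBelow))),
      Zt i s θ' = Zf B Nn St (χ i) (s, res θ') := by
    intro i s θ'
    rw [hZt, hres]
    exact Zst_eq_Zf J P B Nn hStP (χ i) s θ'
  -- continuity
  have hDtc : Continuous Dt := by
    rw [hDt]
    exact (continuous_finsetSum _ fun j _ ↦ (continuous_apply _).dist continuous_const).add
      (continuous_finsetSum _ fun n _ ↦ ((continuous_apply n).comp hresc).dist continuous_const)
  have hφc : Continuous φt := by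
    rw [hφt]; exact continuous_const.max (continuous_const.sub (continuous_const.mul hDtc))
  have hMtc : Continuous Mt := by
    rw [hMt]
    exact continuous_finsetSum _ fun i _ ↦ continuous_circleMeanSquare_Lt J P St _ c ρ'
  have hψc : Continuous fun θ' ↦ φt θ' * Mt θ' := hφc.mul hMtc
  -- values of `φ`
  have hDt0 : ∀ θ', 0 ≤ Dt θ' := fun θ' ↦ by
    rw [hDt]
    exact add_nonneg (Finset.sum_nonneg fun _ _ ↦ dist_nonneg) (Finset.sum_nonneg fun _ _ ↦ dist_nonneg)
  have hφ01 : ∀ θ', 0 ≤ φt θ' ∧ φt θ' ≤ 1 := by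
    intro θ'
    rw [hφt]
    refine ⟨le_max_left _ _, max_le zero_le_one ?_⟩
    have : 0 ≤ 2 / r * Dt θ' := mul_nonneg (by positivity) (hDt0 θ')
    linarith
  have hφpos : ∀ θ', 0 < φt θ' → (∀ j : ↥J, dist (θ' (Sum.inl j)) (θ₀ (Sum.inl j)) < r) ∧
      ∀ n : ↥St, dist (res θ' n) (θf₀ n) < r := by
    intro θ' h
    rw [hφt] at h
    rcases lt_max_iff.1 h with h | h
    · exact absurd h (lt_irrefl 0)
    · have hD : Dt θ' < r / 2 := by
        rw [sub_pos] at h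
        have h' : 2 / r * Dt θ' < 1 := h
        rw [div_mul_eq_mul_div, div_lt_one hr0] at h'
        linarith
      have hsum1 : ∀ j : ↥J, dist (θ' (Sum.inl j)) (θ₀ (Sum.inl j)) ≤ Dt θ' := by
        intro j
        rw [hDt]
        have h1 := Finset.single_le_sum (f := fun j : ↥J ↦ dist (θ' (Sum.inl j)) (θ₀ (Sum.inl j)))
          (fun _ _ ↦ dist_nonneg) (Finset.mem_univ j)
        have h2 : 0 ≤ ∑ n : ↥St, dist (res θ' n) (θf₀ n) := Finset.sum_nonneg fun _ _ ↦ dist_nonneg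
        linarith
      have hsum2 : ∀ n : ↥St, dist (res θ' n) (θf₀ n) ≤ Dt θ' := by
        intro n
        rw [hDt]
        have h1 := Finset.single_le_sum (f := fun n : ↥St ↦ dist (res θ' n) (θf₀ n))
          (fun _ _ ↦ dist_nonneg) (Finset.mem_univ n)
        have h2 : 0 ≤ ∑ j : ↥J, dist (θ' (Sum.inl j)) (θ₀ (Sum.inl j)) :=
          Finset.sum_nonneg fun _ _ ↦ dist_nonneg
        linarith
      exact ⟨fun j ↦ by linarith [hsum1 j], fun n ↦ by linarith [hsum2 n]⟩
  have hφhalf : ∀ θ', Dt θ' ≤ r / 8 → 1 / 2 ≤ φt θ' := by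
    intro θ' h
    rw [hφt]
    refine le_trans ?_ (le_max_right _ _)
    have : 2 / r * Dt θ' ≤ 2 / r * (r / 8) := mul_le_mul_of_nonneg_left h (by positivity)
    have e2 : 2 / r * (r / 8) = 1 / 4 := by field_simp; ring
    linarith
  -- invariance of `φ` under translation of the tail coordinates
  have hφinv : ∀ q' ∈ Tl P St, ∀ (θ' : UnitAddTorus (↥J ⊕ ↥(P.primesBelow))) (u : UnitAddCircle),
      φt (θ' + Pi.single (Sum.inr q') u) = φt θ' := by
    intro q' hq' θ' u
    have hq'St : (q' : ℕ) ∉ St := by unfold Tl at hq'; exact (Finset.mem_filter.1 hq').2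
    have e1 : res (θ' + Pi.single (Sum.inr q') u) = res θ' := by
      rw [hres]
      funext n
      have hne : (Sum.inr ⟨n.1, hStP n.2⟩ : ↥J ⊕ ↥(P.primesBelow)) ≠ Sum.inr q' := by
        intro h
        have h2' : (n : ℕ) = (q' : ℕ) := congrArg Subtype.val (Sum.inr_injective h)
        exact hq'St (h2' ▸ n.2)
      simp only [Pi.add_apply, Pi.single_eq_of_ne hne, add_zero]
    have e2 : ∀ j : ↥J, (θ' + Pi.single (Sum.inr q') u : UnitAddTorus (↥J ⊕ ↥(P.primesBelow)))
        (Sum.inl j) = θ' (Sum.inl j) := by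
      intro j
      simp only [Pi.add_apply, Pi.single_eq_of_ne (Sum.inl_ne_inr : (Sum.inl j : ↥J ⊕ ↥(P.primesBelow)) ≠ Sum.inr q'), add_zero]
    rw [hφt, hDt]
    beta_reduce
    rw [e1]
    simp only [e2]
  -- the box where `φ ≥ 1/2`
  obtain ⟨lo, hlo⟩ : ∃ lo : ↥J ⊕ ↥(P.primesBelow) → Prop, lo = Sum.elim (fun _ : ↥J ↦ True)
      (fun q' : ↥(P.primesBelow) ↦ (q' : ℕ) ∈ St) := ⟨_, rfl⟩
  haveI : DecidablePred lo := fun x ↦ by rw [hlo]; infer_instance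
  have hφbox : ∀ θ' : UnitAddTorus (↥J ⊕ ↥(P.primesBelow)),
      θ' ∈ Set.pi Set.univ (fun x ↦ if lo x then Metric.closedBall (θ₀ x) (rb / 2) else Set.univ) →
      1 / 2 ≤ φt θ' := by
    intro θ' hθ'
    refine hφhalf θ' ?_
    rw [Set.mem_pi] at hθ'
    have hle1 : ∀ j : ↥J, dist (θ' (Sum.inl j)) (θ₀ (Sum.inl j)) ≤ rb / 2 := by
      intro j
      have h1' := hθ' (Sum.inl j) (Set.mem_univ _)
      have : lo (Sum.inl j) := by rw [hlo]; trivial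
      simp only [this, if_true, Metric.mem_closedBall] at h1'
      exact h1'
    have hle2 : ∀ n : ↥St, dist (res θ' n) (θf₀ n) ≤ rb / 2 := by
      intro n
      have h1' := hθ' (Sum.inr ⟨n.1, hStP n.2⟩) (Set.mem_univ _)
      have : lo (Sum.inr ⟨n.1, hStP n.2⟩) := by rw [hlo]; exact n.2
      simp only [this, if_true, Metric.mem_closedBall] at h1'
      rw [← hresθ₀, hres]
      exact h1'
    calc Dt θ' = (∑ j : ↥J, dist (θ' (Sum.inl j)) (θ₀ (Sum.inl j))) +
          ∑ n : ↥St, dist (res θ' n) (θf₀ n) := by rw [hDt]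
      _ ≤ (∑ _j : ↥J, rb / 2) + ∑ _n : ↥St, rb / 2 :=
          add_le_add (Finset.sum_le_sum fun j _ ↦ hle1 j) (Finset.sum_le_sum fun n _ ↦ hle2 n)
      _ = (Mb : ℝ) * (rb / 2) := by
          rw [Finset.sum_const, Finset.sum_const, nsmul_eq_mul, nsmul_eq_mul, Finset.card_univ,
            Finset.card_univ, Fintype.card_coe, Fintype.card_coe, hMbdef]
          push_cast; ring
      _ = r / 8 := by rw [hrbdef]; field_simp; ring
  -- the count of constrained coordinates
  have hcard : (Finset.univ.filter lo).card ≤ Mb := by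
    rw [hMbdef]
    have hmaps : ∀ x ∈ Finset.univ.filter lo, Sum.map id Subtype.val x ∈
        (Finset.univ : Finset ↥J).disjSum St := by
      intro x hx
      have hx' : lo x := (Finset.mem_filter.1 hx).2
      rcases x with j | q'
      · simp only [Sum.map_inl, id_eq, Finset.inl_mem_disjSum, Finset.mem_univ]
      · rw [hlo] at hx'
        simp only [Sum.map_inr, Finset.inr_mem_disjSum]
        exact hx'
    calc (Finset.univ.filter lo).card ≤ ((Finset.univ : Finset ↥J).disjSum St).card :=
          Finset.card_le_card_of_injOn (Sum.map id Subtype.val) hmaps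
            ((Sum.map_injective.2 ⟨fun _ _ h ↦ h, Subtype.val_injective⟩).injOn)
      _ = J.card + St.card := by rw [Finset.card_disjSum, Finset.card_univ, Fintype.card_coe]
  -- the lower bound `c₁ ≤ ∫ φ`
  have hI₁ : c₁ ≤ ∫ θ', φt θ' := by
    have hmeas := measurableSet_box lo θ₀ rb
    have hvol := pow_le_measureReal_box lo θ₀ hrb0 hrb1 hcard
    have hind : ∫ θ' : UnitAddTorus (↥J ⊕ ↥(P.primesBelow)), Set.indicator (Set.pi Set.univ
        (fun x ↦ if lo x then Metric.closedBall (θ₀ x) (rb / 2) else Set.univ))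
        (fun _ ↦ (1 / 2 : ℝ)) θ' ≤ ∫ θ', φt θ' := by
      have hfin := KroneckerWeyl.isProbabilityMeasure_volume_unitAddTorus (ι := ↥J ⊕ ↥(P.primesBelow))
      refine integral_mono ((integrable_const (1 / 2 : ℝ)).indicator hmeas)
        (KroneckerWeyl.integrable_of_continuous hφc) fun θ' ↦ ?_
      by_cases hθ' : θ' ∈ Set.pi Set.univ
          (fun x ↦ if lo x then Metric.closedBall (θ₀ x) (rb / 2) else Set.univ)
      · simp only [Set.indicator_of_mem hθ']; exact hφbox θ' hθ'
      · simp only [Set.indicator_of_notMem hθ']; exact (hφ01 θ').1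
    rw [integral_indicator_const _ hmeas, smul_eq_mul, measureReal_def] at hind
    rw [hc₁def]
    linarith
  -- the tail data
  have hTl4 : ∀ q' ∈ Tl P St, 4 ≤ (q' : ℕ) := fun q' hq' ↦
    hN₁4.trans (houtside q' (Nat.prime_of_mem_primesBelow q'.2)
      (by unfold Tl at hq'; exact (Finset.mem_filter.1 hq').2)).le
  have hTlN₁ : ∀ q' ∈ Tl P St, N₁ ≤ (q' : ℕ) := fun q' hq' ↦
    (houtside q' (Nat.prime_of_mem_primesBelow q'.2)
      (by unfold Tl at hq'; exact (Finset.mem_filter.1 hq').2)).le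
  have hsumsq_le : ∑ q' ∈ Tl P St, ((((q' : ℕ) : ℝ)) ^ (-σ₁)) ^ 2 < d / (8 * π * nι) := by
    have h := sum_sq_Tl_le_tail P hTlN₁ hσ₁half (s := (σ₁ : ℂ)) (by simp)
    simp only [ofReal_re] at h
    exact h.trans_lt htailN
  obtain ⟨sS, hsSdef⟩ : ∃ sS : ℝ, sS = nι * (2 * π * ∑ q' ∈ Tl P St, ((((q' : ℕ) : ℝ)) ^ (-σ₁)) ^ 2) :=
    ⟨_, rfl⟩
  have hsS0 : 0 ≤ sS := by rw [hsSdef]; positivity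
  have hsSd : sS ≤ d / 4 := by
    rw [hsSdef]
    have := mul_lt_mul_of_pos_left hsumsq_le (show (0 : ℝ) < nι * (2 * π) by positivity)
    have e2 : nι * (2 * π) * (d / (8 * π * nι)) = d / 4 := by field_simp; ring
    nlinarith
  have hI₂ : ∫ θ', φt θ' * Mt θ' ≤ sS * ∫ θ', φt θ' := by
    have hper : ∀ i, ∫ θ', φt θ' * ∫ a in (0 : ℝ)..2 * π,
        ‖Lt J P St (fun n ↦ χ i n) (circleMap c ρ' a) θ'‖ ^ 2 ≤
        2 * π * (∑ q' ∈ Tl P St, ((((q' : ℕ) : ℝ)) ^ (-σ₁)) ^ 2) * ∫ θ', φt θ' := fun i ↦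
      integral_mul_circleMeanSquare_Lt_le J P St (fun n ↦ (χ i).norm_le_one _) hφc hφinv
        (fun θ' ↦ (hφ01 θ').1) c ρ' (fun a ↦ (hcm_re a).1)
    have e1 : (fun θ' ↦ φt θ' * Mt θ') = fun θ' ↦ ∑ i, φt θ' * ∫ a in (0 : ℝ)..2 * π,
        ‖Lt J P St (fun n ↦ χ i n) (circleMap c ρ' a) θ'‖ ^ 2 := by
      funext θ'; rw [hMt, Finset.mul_sum]
    rw [e1, integral_finsetSum]
    · calc ∑ i, ∫ θ', φt θ' * ∫ a in (0 : ℝ)..2 * π, ‖Lt J P St (fun n ↦ χ i n) (circleMap c ρ' a) θ'‖ ^ 2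
          ≤ ∑ _i : ι, 2 * π * (∑ q' ∈ Tl P St, ((((q' : ℕ) : ℝ)) ^ (-σ₁)) ^ 2) * ∫ θ', φt θ' :=
            Finset.sum_le_sum fun i _ ↦ hper i
        _ = sS * ∫ θ', φt θ' := by
            rw [Finset.sum_const, nsmul_eq_mul, Finset.card_univ, hsSdef, hnιdef]; ring
    · intro i _
      exact KroneckerWeyl.integrable_of_continuous
        (hφc.mul (continuous_circleMeanSquare_Lt J P St (fun n ↦ χ i n) c ρ'))
  /- Step 8: Kronecker–Weyl for `φ` and `φ · M`, and the choice of `T₁`. -/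
  set Φc : C(UnitAddTorus (↥J ⊕ ↥(P.primesBelow)), ℝ) := ⟨φt, hφc⟩ with hΦc
  set Ψc : C(UnitAddTorus (↥J ⊕ ↥(P.primesBelow)), ℝ) := ⟨fun θ' ↦ φt θ' * Mt θ', hψc⟩ with hΨc
  have hA₁ := KroneckerWeyl.tendsto_avg_integral_comp_flow_real hlin Φc
  have hA₂ := KroneckerWeyl.tendsto_avg_integral_comp_flow_real hlin Ψc
  have hΨcoe : ∀ θ', Ψc θ' = φt θ' * Mt θ' := fun θ' ↦ rfl
  have e1 : ∀ᶠ T : ℝ in atTop, (∫ θ', φt θ') - c₁ / 16 <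
      T⁻¹ * ∫ t in (0 : ℝ)..T, Φc (fun x ↦ ((t * l x : ℝ) : UnitAddCircle)) :=
    hA₁.eventually_const_lt (by show (∫ θ', φt θ') - c₁ / 16 < ∫ θ', φt θ'; linarith)
  have e2 : ∀ᶠ T : ℝ in atTop, T⁻¹ * ∫ t in (0 : ℝ)..T, Ψc (fun x ↦ ((t * l x : ℝ) : UnitAddCircle)) <
      sS * (∫ θ', φt θ') + d * c₁ / 16 :=
    hA₂.eventually_lt_const (by
      have : (0 : ℝ) < d * c₁ / 16 := by positivity
      calc ∫ θ', Ψc θ' = ∫ θ', φt θ' * Mt θ' := rfl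
        _ ≤ sS * ∫ θ', φt θ' := hI₂
        _ < _ := by linarith)
  have e4 : ∀ᶠ T : ℝ in atTop, max T₀ 1 ≤ T := eventually_ge_atTop _
  obtain ⟨T₁, hT₁⟩ := eventually_atTop.1 (e1.and (e2.and e4))
  clear e1 e2 e4 hA₁ hA₂
  refine ⟨c₁ / 4, by positivity, T₁, fun T hT ↦ ?_⟩
  obtain ⟨h1T, h2T, h4T⟩ := hT₁ T hT
  have hTT₀ : T₀ ≤ T := (le_max_left _ _).trans h4T
  have hT1 : 1 ≤ T := (le_max_right _ _).trans h4T
  have hT0 : 0 < T := by linarith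
  /- Step 9: the time integrals. -/
  have hflow : Continuous fun t : ℝ ↦ (fun x ↦ ((t * l x : ℝ) : UnitAddCircle) :
      UnitAddTorus (↥J ⊕ ↥(P.primesBelow))) := KroneckerWeyl.continuous_flow l
  have hflow_eq : ∀ t : ℝ, (fun x ↦ ((t * l x : ℝ) : UnitAddCircle) :
      UnitAddTorus (↥J ⊕ ↥(P.primesBelow))) = flow J P B Nn α t := by
    intro t; rw [hl]; rfl
  obtain ⟨Φ, hΦ⟩ : ∃ Φ : ℝ → ℝ, Φ = fun t : ℝ ↦ φt (fun x ↦ ((t * l x : ℝ) : UnitAddCircle)) :=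
    ⟨_, rfl⟩
  obtain ⟨Λ, hΛ⟩ : ∃ Λ : ℝ → ℝ, Λ = fun t : ℝ ↦ Mt (fun x ↦ ((t * l x : ℝ) : UnitAddCircle)) :=
    ⟨_, rfl⟩
  obtain ⟨Ef, hEf⟩ : ∃ Ef : ι → ℝ → ℝ → ℝ, Ef = fun i (t : ℝ) (a : ℝ) ↦
      ‖(χ i).LFunction (circleMap c ρ' a + (t : ℂ) * I) -
        ∏ p ∈ P.primesBelow, (1 - χ i p * (p : ℂ) ^ (-(circleMap c ρ' a + (t : ℂ) * I)))⁻¹‖ ^ 2 :=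
    ⟨_, rfl⟩
  obtain ⟨E, hE⟩ : ∃ E : ℝ → ℝ, E = fun t ↦ ∑ i, ∫ a in (0 : ℝ)..2 * π, Ef i t a := ⟨_, rfl⟩
  have hΦcont : Continuous Φ := by rw [hΦ]; exact hφc.comp hflow
  have hΛcont : Continuous Λ := by rw [hΛ]; exact hMtc.comp hflow
  have hEfc : ∀ i, Continuous (Function.uncurry (Ef i)) := by
    intro i; rw [hEf]; exact continuous_LFunction_sub_eulerProduct_circle (χ i) hρ'0.le hσ₁ hσ₂ P
  have hEic : ∀ i, Continuous fun t ↦ ∫ a in (0 : ℝ)..2 * π, Ef i t a := fun i ↦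
    intervalIntegral.continuous_parametric_intervalIntegral_of_continuous' (hEfc i) _ _
  have hEcont : Continuous E := by
    rw [hE]; exact continuous_finsetSum _ fun i _ ↦ hEic i
  have hΦ01 : ∀ t, 0 ≤ Φ t ∧ Φ t ≤ 1 := fun t ↦ by rw [hΦ]; exact hφ01 _
  have hΛ0 : ∀ t, 0 ≤ Λ t := by
    intro t; rw [hΛ, hMt]
    exact Finset.sum_nonneg fun i _ ↦
      intervalIntegral.integral_nonneg (by positivity) fun a _ ↦ by positivity
  have hEf0 : ∀ i t a, 0 ≤ Ef i t a := fun i t a ↦ by rw [hEf]; positivity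
  have hEi0 : ∀ i t, 0 ≤ ∫ a in (0 : ℝ)..2 * π, Ef i t a := fun i t ↦
    intervalIntegral.integral_nonneg (by positivity) fun a _ ↦ hEf0 i t a
  have hE0 : ∀ t, 0 ≤ E t := by
    intro t; rw [hE]; exact Finset.sum_nonneg fun i _ ↦ hEi0 i t
  -- `J₁ = T A₁`
  have hJ₁ : ∫ t in (0 : ℝ)..T, Φ t =
      T * (T⁻¹ * ∫ t in (0 : ℝ)..T, Φc (fun x ↦ ((t * l x : ℝ) : UnitAddCircle))) := by
    rw [← mul_assoc, mul_inv_cancel₀ hT0.ne', one_mul, hΦ]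
    rfl
  -- `J₂ = T A₂`
  have hJ₂ : ∫ t in (0 : ℝ)..T, Φ t * Λ t ≤
      T * (T⁻¹ * ∫ t in (0 : ℝ)..T, Ψc (fun x ↦ ((t * l x : ℝ) : UnitAddCircle))) := by
    rw [← mul_assoc, mul_inv_cancel₀ hT0.ne', one_mul]
    have e : (fun t : ℝ ↦ Ψc (fun x ↦ ((t * l x : ℝ) : UnitAddCircle))) = fun t ↦ Φ t * Λ t := by
      funext t; rw [hΨcoe, hΦ, hΛ]
    rw [e]
  -- `J₃ ≤ (e c₁/4) T`
  have hJ₃ : ∫ t in (0 : ℝ)..T, Φ t * E t ≤ e * c₁ / 4 * T := by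
    have hEb : ∀ i, ∫ t in (0 : ℝ)..T, (∫ a in (0 : ℝ)..2 * π, Ef i t a) ≤ 2 * π * εE * T := by
      intro i
      refine integral_circleMeanSquare_le (hEfc i) hT0.le fun a _ ↦ ?_
      have h := hT₀i i T ((hT₀ i).trans hTT₀) (circleMap c ρ' a).re (hcm_re a).1 (hcm_re a).2
        (circleMap c ρ' a).im (hcm_im a)
      have e3 : ∀ t : ℝ, ((circleMap c ρ' a).re : ℂ) + (t + (circleMap c ρ' a).im) * I =
          circleMap c ρ' a + t * I := by
        intro t
        conv_rhs => rw [← re_add_im (circleMap c ρ' a)]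
        ring
      simp only [e3] at h
      rw [hEf]
      exact h
    have hEsum : ∫ t in (0 : ℝ)..T, E t ≤ nι * (2 * π * εE * T) := by
      rw [hE, intervalIntegral.integral_finsetSum (fun i _ ↦ (hEic i).intervalIntegrable _ _)]
      calc ∑ i, ∫ t in (0 : ℝ)..T, ∫ a in (0 : ℝ)..2 * π, Ef i t a ≤ ∑ _i : ι, 2 * π * εE * T :=
            Finset.sum_le_sum fun i _ ↦ hEb i
        _ = nι * (2 * π * εE * T) := by rw [Finset.sum_const, nsmul_eq_mul, Finset.card_univ, hnιdef]
    have hle : ∫ t in (0 : ℝ)..T, Φ t * E t ≤ ∫ t in (0 : ℝ)..T, E t :=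
      intervalIntegral.integral_mono_on hT0.le ((hΦcont.mul hEcont).intervalIntegrable _ _)
        (hEcont.intervalIntegrable _ _) fun t _ ↦ mul_le_of_le_one_left (hE0 t) (hΦ01 t).2
    have e5 : nι * (2 * π * εE * T) = e * c₁ / 4 * T := by rw [hεEdef]; field_simp; ring
    linarith
  -- the test integrand `gt = Φ (1 - Λ/d - E/e)`
  obtain ⟨gt, hgt⟩ : ∃ gt : ℝ → ℝ, gt = fun t ↦ Φ t * (1 - Λ t / d - E t / e) := ⟨_, rfl⟩
  have hgtc : Continuous gt := by
    rw [hgt]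
    exact hΦcont.mul ((continuous_const.sub (hΛcont.div_const _)).sub (hEcont.div_const _))
  have hgt1 : ∀ t, gt t ≤ 1 := by
    intro t
    rw [hgt]
    have h1' : 1 - Λ t / d - E t / e ≤ 1 := by
      have := div_nonneg (hΛ0 t) hd0.le
      have := div_nonneg (hE0 t) he0.le
      linarith
    calc Φ t * (1 - Λ t / d - E t / e) ≤ Φ t * 1 :=
          mul_le_mul_of_nonneg_left h1' (hΦ01 t).1
      _ ≤ 1 := by rw [mul_one]; exact (hΦ01 t).2
  have hg_int : ∫ t in (0 : ℝ)..T, gt t =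
      (∫ t in (0 : ℝ)..T, Φ t) - (∫ t in (0 : ℝ)..T, Φ t * Λ t) / d -
        (∫ t in (0 : ℝ)..T, Φ t * E t) / e := by
    have hi1 : IntervalIntegrable Φ volume 0 T := hΦcont.intervalIntegrable _ _
    have hi2 : IntervalIntegrable (fun t ↦ Φ t * Λ t / d) volume 0 T :=
      ((hΦcont.mul hΛcont).div_const _).intervalIntegrable _ _
    have hi3 : IntervalIntegrable (fun t ↦ Φ t * E t / e) volume 0 T :=
      ((hΦcont.mul hEcont).div_const _).intervalIntegrable _ _
    have e6 : gt = fun t ↦ Φ t - Φ t * Λ t / d - Φ t * E t / e := by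
      rw [hgt]; funext t; ring
    rw [e6, intervalIntegral.integral_sub (hi1.sub hi2) hi3, intervalIntegral.integral_sub hi1 hi2,
      intervalIntegral.integral_div, intervalIntegral.integral_div]
  have hlow : c₁ / 4 * T ≤ ∫ t in (0 : ℝ)..T, gt t := by
    rw [hg_int]
    exact integral_bookkeeping hT0 hc₁0 hI₁ hd0 hsSd he0 h1T h2T hJ₁ hJ₂ hJ₃
  /- Step 10: good shifts. -/
  refine (ENNReal.ofReal_le_ofReal hlow).trans (ofReal_integral_le_volume hgtc hgt1 hT0.le ?_)
  intro t _ hgpos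
  -- unpack `gt t > 0`
  have hΦt : 0 < Φ t ∧ 0 < 1 - Λ t / d - E t / e := by
    rw [hgt] at hgpos
    rcases pos_and_pos_or_neg_and_neg_of_mul_pos hgpos with h | h
    · exact h
    · exact absurd h.1 (not_lt.2 (hΦ01 t).1)
  have hΛt : Λ t < d := by
    have h0 : 0 ≤ E t / e := div_nonneg (hE0 t) he0.le
    have : Λ t / d < 1 := by linarith [hΦt.2]
    rwa [div_lt_one hd0] at this
  have hEt : E t < e := by
    have h0 : 0 ≤ Λ t / d := div_nonneg (hΛ0 t) hd0.le
    have : E t / e < 1 := by linarith [hΦt.2]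
    rwa [div_lt_one he0] at this
  -- the torus point `θt = flow t`
  set θt : UnitAddTorus (↥J ⊕ ↥(P.primesBelow)) := fun x ↦ ((t * l x : ℝ) : UnitAddCircle) with hθt
  have hθt_flow : θt = flow J P B Nn α t := hflow_eq t
  have hφθt : 0 < φt θt := by have := hΦt.1; rwa [hΦ] at this
  obtain ⟨hnearJ, hnearSt⟩ := hφpos θt hφθt
  refine ⟨fun i ↦ ?_, ?_⟩
  · /- the `L`-functions -/
    refine norm_LFunction_sub_lt_of_good J St hTl4 (χ i) h1 θt t (Z := fun s ↦ Zt i s θt) hε1 hδ₁s hKδ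
      (hMg i) ?_ ?_ ?_ ?_ ?_
    · -- `Z(s, θt)` is `ε/4`-close to `fᵢ`
      intro s hs
      rw [hZtf]
      exact hbox i (res θt) hnearSt s hs
    · -- `|L(s, θt)| < δ₁` from `Λ t < d` and Cauchy
      intro s hs
      have hC := norm_sq_Lt_le J P St (fun n ↦ χ i n) hρ.le hρρ' θt hs
      have hΛi : ∫ a in (0 : ℝ)..2 * π, ‖Lt J P St (fun n ↦ χ i n) (circleMap c ρ' a) θt‖ ^ 2 ≤ Λ t := by
        rw [hΛ, hMt]
        exact Finset.single_le_sum (f := fun i ↦ ∫ a in (0 : ℝ)..2 * π,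
          ‖Lt J P St (fun n ↦ χ i n) (circleMap c ρ' a) θt‖ ^ 2)
          (fun i _ ↦ intervalIntegral.integral_nonneg (by positivity) fun a _ ↦ by positivity)
          (Finset.mem_univ i)
      rw [← hCcdef] at hC
      have hlt : ‖Lt J P St (fun n ↦ χ i n) s θt‖ ^ 2 < δ₁ ^ 2 := by
        calc _ ≤ Cc * Λ t := hC.trans (mul_le_mul_of_nonneg_left hΛi hCc0.le)
          _ < Cc * d := mul_lt_mul_of_pos_left hΛt hCc0
          _ = δ₁ ^ 2 := hCcd
      exact lt_of_pow_lt_pow_left₀ 2 hδ₁0.le hlt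
    · -- the tail `Σ q^{-2 Re s} ≤ δ₁`
      intro s hs
      have hsre : σ₁ ≤ s.re := by
        obtain ⟨ha, -⟩ := abs_le.1 (abs_re_sub_re_le_of_mem_closedBall hs)
        rw [hσ₁def]; linarith
      refine ((sum_sq_Tl_le_tail P hTlN₁ hσ₁half hsre).trans htailN.le).trans htail_le
    · -- the Euler product along the flow
      intro s
      rw [hZt, hθt_flow]
      exact eulerProduct_flow_split J P B hNn hBSt (fun n ↦ χ i n) α s t
    · -- `|L − L_P| < ε/4` from `E t < e` and Cauchy
      intro s hs
      have hC := norm_sq_LFunction_sub_eulerProduct_le (χ i) hρ.le hρρ' hσ₁ hσ₂ P t hs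
      have hEi : ∫ a in (0 : ℝ)..2 * π, ‖(χ i).LFunction (circleMap c ρ' a + t * I) -
          ∏ p ∈ P.primesBelow, (1 - χ i p * (p : ℂ) ^ (-(circleMap c ρ' a + t * I)))⁻¹‖ ^ 2 ≤ E t := by
        rw [hE]
        have := Finset.single_le_sum (f := fun i ↦ ∫ a in (0 : ℝ)..2 * π, Ef i t a)
          (fun i _ ↦ hEi0 i t) (Finset.mem_univ i)
        refine le_of_eq_of_le ?_ this
        simp only [hEf]
      rw [← hCcdef] at hC
      have hlt : ‖(χ i).LFunction (s + t * I) -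
          ∏ p ∈ P.primesBelow, (1 - χ i p * (p : ℂ) ^ (-(s + t * I)))⁻¹‖ ^ 2 < (ε / 4) ^ 2 := by
        calc _ ≤ Cc * E t := hC.trans (mul_le_mul_of_nonneg_left hEi hCc0.le)
          _ < Cc * e := mul_lt_mul_of_pos_left hEt hCc0
          _ = (ε / 4) ^ 2 := hCce
      exact lt_of_pow_lt_pow_left₀ 2 (by positivity) hlt
  · /- the Kronecker–Weyl part: `‖t αₖ − θₖ‖ < ε` -/
    intro k
    have hJ' : ∀ j ∈ J, ∃ m : ℤ, |t * α j / Nn - θ j / Nn - m| < r := by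
      intro j hj
      have h := hnearJ ⟨j, hj⟩
      have e1 : θt (Sum.inl ⟨j, hj⟩) = (((t * (α j / Nn)) : ℝ) : UnitAddCircle) := by
        rw [hθt, hl]; rfl
      have e2 : θ₀ (Sum.inl ⟨j, hj⟩) = (((θ j / Nn : ℝ)) : UnitAddCircle) := by rw [hθ₀]; rfl
      rw [e1, e2] at h
      obtain ⟨m, hm⟩ := exists_int_of_dist_coe_lt h
      exact ⟨m, by rwa [mul_div_assoc]⟩
    have hB' : ∀ p ∈ B, ∃ m : ℤ, |t * Pankowski.ell p / Nn - θB p - m| < r := by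
      intro p hp
      have hpSt : p ∈ St := hBSt hp
      have hpM : p ∉ M := Finset.disjoint_right.1 hMB hp
      have h := hnearSt ⟨p, hpSt⟩
      have e1 : res θt ⟨p, hpSt⟩ = (((t * (-(Pankowski.ell p / Nn))) : ℝ) : UnitAddCircle) := by
        rw [hres, hθt, hl]
        simp only [freq, Sum.elim_inr, if_pos hp]
      have e2 : θf₀ ⟨p, hpSt⟩ = (((-θB p : ℝ)) : UnitAddCircle) := by
        rw [hθf₀]; simp only [if_neg hpM]
      rw [e1, e2] at h
      obtain ⟨m, hm⟩ := exists_int_of_dist_coe_lt h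
      refine ⟨-m, ?_⟩
      have e3 : t * Pankowski.ell p / Nn - θB p - ((-m : ℤ) : ℝ) =
          -(t * -(Pankowski.ell p / Nn) - -θB p - m) := by push_cast; ring
      rw [e3, abs_neg]
      exact hm
    obtain ⟨m, hm⟩ := htransfer t r hr0 hJ' hB' k
    refine ⟨m, hm.trans_le ?_⟩
    calc L * r ≤ L * eK := mul_le_mul_of_nonneg_left hreK hL.le
      _ ≤ ε := hLeK.le

end Literature.NumberTheory.LFunctions
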